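import Summits.HodgeConjecture.CorCM.IrreducibleOddWeightsCertificateCMFields
import Summits.HodgeConjecture.CorCM.IrreducibleOddWeightsCertificateParity
import Summits.HodgeConjecture.CorCM.IrreducibleOddWeightsRestrictionCMFields
import HarnessLib

/-!
# Wedderburn certificates VI: one CM type — Mai's criterion literally; «pairs decide» when all `r_k = 1`; the formula
# from a FULL certificate (odd members selected automatically)

COR-CM (cell `pub-hodgecm2`, binder seat `b16` gen 58, count-neutral claim CERTIFICATES (+ HELLY NUMBER), file F7 — CM
fields; theorems only, no definition, no named fact, no `sorry`).  NEW as stated, hence under `Summits/`.  HONEST FRAMING: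
unconditional statements about the rank of ONE CM type (`dim MT(A_Φ)`) and about products of CM abelian varieties, read
through an ODD CERTIFICATE of `Gal(L/ℚ)` (F1–F5: `Z_k`-linear non-zero `π_k` with `π_k(ρ) = −1`, `2 Σ_k r_k d_k ≤ |Gal(L/ℚ)|`,
odd functions faithful); `HC_CM` is neither used nor asserted.

* **`cmTypeRank_eq_one_add_sum_of_oddCertificate`** — `dim MT(A_Φ) = 1 + Σ_k r_k · rank_ℚ π_k(u_Ψ)` for a CM type `Φ` of a CM
  field `F ⊆ L` (`Ψ = {g | ι ∘ g ∘ e₁ ∈ Φ}`, `π_k(u) = Σ_g u(g)π_k(g)`): Mai's `rank = Σ_π d_π rank π(τ)` with CERTIFIED weights;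
  **`isNondegenerate_iff_sum_eq_of_oddCertificate`** (`Φ` nondegenerate iff that sum is `[F:ℚ]/2`).
* **`isNondegenerate_iff_forall_range_eq_top_of_oddCertificate`** — MAI'S CRITERION LITERALLY for a GALOIS CM field `L`:
  `Φ` is nondegenerate iff `π_k(u_Ψ)` is invertible for every odd `π_k` of the certificate.
* **`isNondegenerateFamily_iff_forall_card_le_two_of_oddCertificate`** — PAIRS DECIDE when every odd member has `r_k = 1`
  (`V_k = Z_k`: abelian closures, but also QUATERNION closures `V = Z = ℍ_ℚ`): `Hg(∏_i A_i) = ∏_i Hg(A_i)` of maximal rank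
  iff so for every pair of factors (the tree had the abelian case, `isNondegenerateFamily_iff_pairwise_of_forall_isNondegenerate`).
* **`cmFamilyRank_eq_one_add_sum_odd_of_certificate`**, `isNondegenerateFamily_iff_sum_odd_eq_of_certificate` — the same
  formula and test from a FULL certificate of `Gal(L/ℚ)` (ALL irreducibles, `Σ_k r_k d_k ≤ |Gal|`, `ℚ^{Gal}` faithful): the
  sum runs over the odd members `{k // π_k(ρ) = −1}`, selected by F6 (`oddFaithful_of_certificate`,
  `two_mul_sum_odd_le_card_of_certificate`).

## References

* [Mai1989] L. Mai, *Lower bounds for the ranks of CM types*, J. Number Theory 32 (1989), §2 Prop. 1.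
* [Kubota1965] T. Kubota, *On the field extension by complex multiplication*, Trans. AMS 118 (1965), §4 Lemma 2.
* [Gordon1999HodgeAVSurvey] B. B. Gordon, *A survey of the Hodge conjecture for abelian varieties*, Thm. 6.4, 7.5–7.7.
-/

set_option autoImplicit false

noncomputable section

open scoped BigOperators

open NumberField

universe u'

namespace Summit.HodgeConjecture.CorCM

open Literature.NumberTheory.ComplexMultiplication
open Literature.AlgebraicGeometry.Motives (CMType)
open Literature.AlgebraicGeometry.Pohlmann1968

variable {I : Type} [Fintype I] {K : I → Type} [∀ i, Field (K i)] [∀ i, NumberField (K i)] [∀ i, IsCMField (K i)]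
  {L : Type} [Field L] [NumberField L] [IsCMField L] [Normal ℚ L]
  {κ : Type u'} [Fintype κ] {V : κ → Type*} [∀ k, AddCommGroup (V k)] [∀ k, Module ℚ (V k)]
  [∀ k, FiniteDimensional ℚ (V k)]
  {Z : κ → Type*} [∀ k, DivisionRing (Z k)] [∀ k, Module (Z k) (V k)] [∀ k, Module.Finite (Z k) (V k)]

/-! ### §1 One CM type -/

/-- **ONE CM TYPE: `dim MT(A_Φ) = cmTypeRank Φ = 1 + Σ_k r_k · rank_ℚ π_k(u_Ψ)`** (`Ψ = {g | ι ∘ g ∘ e₁ ∈ Φ}`, CM field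
`F ⊆ L`, odd certificate of `Gal(L/ℚ)`) — Mai's `rank = Σ_π d_π rank π(τ)` with certified weights. [cite: Mai1989, §2 Prop. 1] -/
theorem cmTypeRank_eq_one_add_sum_of_oddCertificate {F : Type} [Field F] [NumberField F] (ι : L →+* ℂ) (e₁ : F →+* L)
    (ρ : L ≃ₐ[ℚ] L) (hρ : ∀ x, ι (ρ x) = starRingEnd ℂ (ι x)) (Φ : CMType F)
    (π : ∀ k, Representation ℚ (L ≃ₐ[ℚ] L) (V k)) [∀ k, Nontrivial (V k)]
    (hlin : ∀ k (g : L ≃ₐ[ℚ] L) (z : Z k) (v : V k), π k g (z • v) = z • π k g v) (hodd : ∀ k (v : V k), π k ρ v = -v)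
    (hcount : 2 * ∑ k, Module.finrank (Z k) (V k) * Module.finrank ℚ (V k) ≤ Fintype.card (L ≃ₐ[ℚ] L))
    (hfaith : ∀ c : (L ≃ₐ[ℚ] L) → ℚ, (∀ g, c (ρ * g) = -c g) → (∀ k, ∑ g, c g • π k g = 0) → c = 0) :
    cmTypeRank Φ = 1 + ∑ k, Module.finrank (Z k) (V k) *
      Module.finrank ℚ (LinearMap.range (∑ g : L ≃ₐ[ℚ] L,
        antiVec ({g : L ≃ₐ[ℚ] L | (ι.comp (g : L →+* L)).comp e₁ ∈ Φ.1} : Set (L ≃ₐ[ℚ] L)) (1 : L ≃ₐ[ℚ] L) g •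
          π k g)) := by
  rw [← cmFamilyRank_punit_eq_cmTypeRank Φ, cmFamilyRank_eq_one_add_sum_of_oddCertificate ι (fun _ : PUnit => e₁) ρ
    hρ (fun _ => Φ) π hlin hodd hcount hfaith]
  congr 1
  refine Finset.sum_congr rfl fun k _ => ?_
  congr 1
  apply congrArg (fun S : Submodule ℚ (V k) => Module.finrank ℚ S)
  exact iSup_const

/-- **ONE CM TYPE: `Φ` is nondegenerate iff `Σ_k r_k · rank_ℚ π_k(u_Ψ) = [F:ℚ]/2`** (odd certificate of `Gal(L/ℚ)`,
`F ⊆ L`). [cite: Mai1989, §2 Prop. 1] [cite: Gordon1999HodgeAVSurvey, Thm. 6.4 and 7.5] -/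
theorem isNondegenerate_iff_sum_eq_of_oddCertificate {F : Type} [Field F] [NumberField F] (ι : L →+* ℂ) (e₁ : F →+* L)
    (ρ : L ≃ₐ[ℚ] L) (hρ : ∀ x, ι (ρ x) = starRingEnd ℂ (ι x)) (Φ : CMType F)
    (π : ∀ k, Representation ℚ (L ≃ₐ[ℚ] L) (V k)) [∀ k, Nontrivial (V k)]
    (hlin : ∀ k (g : L ≃ₐ[ℚ] L) (z : Z k) (v : V k), π k g (z • v) = z • π k g v) (hodd : ∀ k (v : V k), π k ρ v = -v)
    (hcount : 2 * ∑ k, Module.finrank (Z k) (V k) * Module.finrank ℚ (V k) ≤ Fintype.card (L ≃ₐ[ℚ] L))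
    (hfaith : ∀ c : (L ≃ₐ[ℚ] L) → ℚ, (∀ g, c (ρ * g) = -c g) → (∀ k, ∑ g, c g • π k g = 0) → c = 0) :
    IsNondegenerate Φ ↔ ∑ k, Module.finrank (Z k) (V k) *
      Module.finrank ℚ (LinearMap.range (∑ g : L ≃ₐ[ℚ] L,
        antiVec ({g : L ≃ₐ[ℚ] L | (ι.comp (g : L →+* L)).comp e₁ ∈ Φ.1} : Set (L ≃ₐ[ℚ] L)) (1 : L ≃ₐ[ℚ] L) g •
          π k g)) = Module.finrank ℚ F / 2 := by
  rw [isNondegenerate_iff, cmTypeRank_eq_one_add_sum_of_oddCertificate ι e₁ ρ hρ Φ π hlin hodd hcount hfaith]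
  omega

omit [Normal ℚ L] in
/-- **MAI'S CRITERION FOR A GALOIS CM FIELD, LITERALLY**: a CM type `Φ` of the Galois CM field `L` is nondegenerate iff
`π_k(u_Ψ)` is invertible (onto) for every odd `π_k` of the certificate, `Ψ = {g | ι ∘ g ∈ Φ}`. [cite: Mai1989, §2 Prop. 1] -/
theorem isNondegenerate_iff_forall_range_eq_top_of_oddCertificate [IsGalois ℚ L] (ι : L →+* ℂ) (ρ : L ≃ₐ[ℚ] L)
    (hρ : ∀ x, ι (ρ x) = starRingEnd ℂ (ι x)) (Φ : CMType L)
    (π : ∀ k, Representation ℚ (L ≃ₐ[ℚ] L) (V k)) [∀ k, Nontrivial (V k)]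
    (hlin : ∀ k (g : L ≃ₐ[ℚ] L) (z : Z k) (v : V k), π k g (z • v) = z • π k g v) (hodd : ∀ k (v : V k), π k ρ v = -v)
    (hcount : 2 * ∑ k, Module.finrank (Z k) (V k) * Module.finrank ℚ (V k) ≤ Fintype.card (L ≃ₐ[ℚ] L))
    (hfaith : ∀ c : (L ≃ₐ[ℚ] L) → ℚ, (∀ g, c (ρ * g) = -c g) → (∀ k, ∑ g, c g • π k g = 0) → c = 0) :
    IsNondegenerate Φ ↔ ∀ k, LinearMap.range (∑ g : L ≃ₐ[ℚ] L,
      antiVec ({g : L ≃ₐ[ℚ] L | ι.comp (g : L →+* L) ∈ Φ.1} : Set (L ≃ₐ[ℚ] L)) (1 : L ≃ₐ[ℚ] L) g • π k g) = ⊤ := by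
  classical
  have hΨ' := isCMTypeWith_gal_family ι (fun _ : PUnit => RingHom.id L) ρ hρ (fun _ => Φ) PUnit.unit
  have hset : ({g : L ≃ₐ[ℚ] L | (ι.comp (g : L →+* L)).comp (RingHom.id L) ∈ Φ.1} : Set (L ≃ₐ[ℚ] L)) =
      {g : L ≃ₐ[ℚ] L | ι.comp (g : L →+* L) ∈ Φ.1} := by
    ext g
    simp only [Set.mem_setOf_eq, RingHom.comp_id]
  have hΨ : IsCMTypeWith ρ ({g : L ≃ₐ[ℚ] L | ι.comp (g : L →+* L) ∈ Φ.1} : Set (L ≃ₐ[ℚ] L)) := hset ▸ hΨ'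
  have hcount' : ∑ k, Module.finrank (Z k) (V k) * Module.finrank ℚ (V k) ≤
      Module.finrank ℚ (antiWeights (E := L ≃ₐ[ℚ] L) ρ) := by
    have := IrrOdd.card_le_two_mul_finrank_antiWeights hΨ
    omega
  have hcard : Module.finrank ℚ L = Fintype.card (L ≃ₐ[ℚ] L) := by
    rw [← Nat.card_eq_fintype_card, IsGalois.card_aut_eq_finrank]
  rw [isNondegenerate_iff, cmTypeRank_eq_typeRank_gal_member ι (fun _ : PUnit => RingHom.id L) (fun _ => Φ) PUnit.unit,
    hset, hcard]
  exact IrrOdd.typeRank_eq_iff_forall_range_eq_top_of_oddCertificate hΨ π hlin (conj_mul_conj_eq_one ι ρ hρ) hodd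
    hcount' hfaith

/-! ### §2 Pairs decide when all `r_k = 1` -/

/-- **PAIRS DECIDE when every odd member of the certificate has `r_k = 1`** (`V_k = Z_k`: every ABELIAN closure, but also
e.g. QUATERNION closures, `V = Z = ℍ_ℚ`): `Hg(∏_i A_i) = ∏_i Hg(A_i)` of maximal rank iff so for every PAIR. [cite: Mai1989, §2 Prop. 1] -/
theorem isNondegenerateFamily_iff_forall_card_le_two_of_oddCertificate [Nonempty I] (ι : L →+* ℂ) (e : ∀ i, K i →+* L)
    (ρ : L ≃ₐ[ℚ] L) (hρ : ∀ x, ι (ρ x) = starRingEnd ℂ (ι x)) (Φ : ∀ i, CMType (K i))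
    (π : ∀ k, Representation ℚ (L ≃ₐ[ℚ] L) (V k)) [∀ k, Nontrivial (V k)]
    (hlin : ∀ k (g : L ≃ₐ[ℚ] L) (z : Z k) (v : V k), π k g (z • v) = z • π k g v) (hodd : ∀ k (v : V k), π k ρ v = -v)
    (hcount : 2 * ∑ k, Module.finrank (Z k) (V k) * Module.finrank ℚ (V k) ≤ Fintype.card (L ≃ₐ[ℚ] L))
    (hfaith : ∀ c : (L ≃ₐ[ℚ] L) → ℚ, (∀ g, c (ρ * g) = -c g) → (∀ k, ∑ g, c g • π k g = 0) → c = 0)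
    (h1 : ∀ k, Module.finrank (Z k) (V k) = 1) :
    CMAlgebra.IsNondegenerateFamily Φ ↔
      ∀ T : Finset I, T.Nonempty → T.card ≤ 2 →
        CMAlgebra.IsNondegenerateFamily (K := fun j : (T : Set I) => K j) fun j => Φ j :=
  isNondegenerateFamily_iff_forall_card_le_of_oddCertificate ι e ρ hρ Φ π hlin hodd hcount hfaith 1 fun k => (h1 k).le


/-! ### §3 From a FULL certificate: the odd members are selected automatically -/

omit [∀ i, IsCMField (K i)] in
open scoped Classical in
/-- **`dim MT(∏_i A_i) = 1 + Σ_{π_k(ρ) = −1} r_k · dim_ℚ Σ_i range π_k(u_{Ψ_i})` FROM A FULL CERTIFICATE OF `Gal(L/ℚ)`**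
(ALL irreducible `ℚ`-representations: `Z_k`-linear, non-zero, `Σ_k r_k d_k ≤ |Gal(L/ℚ)|`, `ℚ^{Gal}` faithful) — the even
members drop out (F6: parity, odd faithfulness, odd count). [cite: Mai1989, §2 Prop. 1] [cite: Serre1977, §6.5 Prop. 16 and §12.2] -/
theorem cmFamilyRank_eq_one_add_sum_odd_of_certificate [Nonempty I] (ι : L →+* ℂ) (e : ∀ i, K i →+* L)
    (ρ : L ≃ₐ[ℚ] L) (hρ : ∀ x, ι (ρ x) = starRingEnd ℂ (ι x)) (Φ : ∀ i, CMType (K i))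
    (π : ∀ k, Representation ℚ (L ≃ₐ[ℚ] L) (V k)) [∀ k, Nontrivial (V k)]
    (hlin : ∀ k (g : L ≃ₐ[ℚ] L) (z : Z k) (v : V k), π k g (z • v) = z • π k g v)
    (hcount : ∑ k, Module.finrank (Z k) (V k) * Module.finrank ℚ (V k) ≤ Fintype.card (L ≃ₐ[ℚ] L))
    (hfaith : ∀ c : (L ≃ₐ[ℚ] L) → ℚ, (∀ k, ∑ g, c g • π k g = 0) → c = 0) :
    CMAlgebra.cmFamilyRank Φ = 1 + ∑ k : {k : κ // ∀ v, π k ρ v = -v}, Module.finrank (Z k.1) (V k.1) *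
      Module.finrank ℚ (⨆ i, LinearMap.range (∑ g : L ≃ₐ[ℚ] L,
          antiVec ({g : L ≃ₐ[ℚ] L | (ι.comp (g : L →+* L)).comp (e i) ∈ (Φ i).1} : Set (L ≃ₐ[ℚ] L))
            (1 : L ≃ₐ[ℚ] L) g • π k.1 g) : Submodule ℚ (V k.1)) := by
  obtain ⟨i₀⟩ := ‹Nonempty I›
  have hΨ := isCMTypeWith_gal_family ι e ρ hρ Φ i₀
  have hρc : ∀ g : L ≃ₐ[ℚ] L, g * ρ = ρ * g := fun g => by
    have := hΨ.comm g (1 : L ≃ₐ[ℚ] L)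
    simp only [smul_eq_mul, mul_one] at this
    exact this
  have hρ2 : ρ * ρ = 1 := conj_mul_conj_eq_one ι ρ hρ
  exact cmFamilyRank_eq_one_add_sum_of_oddCertificate ι e ρ hρ Φ (fun k : {k : κ // ∀ v, π k ρ v = -v} => π k.1)
    (fun k g z v => hlin k.1 g z v) (fun k v => k.2 v)
    (IrrOdd.two_mul_sum_odd_le_card_of_certificate π hlin hcount hfaith hΨ)
    (fun c hc h0 => IrrOdd.oddFaithful_of_certificate π hlin hcount hfaith hρc hρ2 c hc h0)

omit [∀ i, IsCMField (K i)] in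
open scoped Classical in
/-- **Nondegeneracy from a FULL certificate of `Gal(L/ℚ)`**: `Hg(∏_i A_i) = ∏_i Hg(A_i)` of maximal rank iff
`Σ_{π_k(ρ) = −1} r_k · dim_ℚ Σ_i range π_k(u_{Ψ_i}) = Σ_i [K_i:ℚ]/2`. [cite: Mai1989, §2 Prop. 1] [cite: Gordon1999HodgeAVSurvey, 7.5] -/
theorem isNondegenerateFamily_iff_sum_odd_eq_of_certificate [Nonempty I] (ι : L →+* ℂ) (e : ∀ i, K i →+* L)
    (ρ : L ≃ₐ[ℚ] L) (hρ : ∀ x, ι (ρ x) = starRingEnd ℂ (ι x)) (Φ : ∀ i, CMType (K i))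
    (π : ∀ k, Representation ℚ (L ≃ₐ[ℚ] L) (V k)) [∀ k, Nontrivial (V k)]
    (hlin : ∀ k (g : L ≃ₐ[ℚ] L) (z : Z k) (v : V k), π k g (z • v) = z • π k g v)
    (hcount : ∑ k, Module.finrank (Z k) (V k) * Module.finrank ℚ (V k) ≤ Fintype.card (L ≃ₐ[ℚ] L))
    (hfaith : ∀ c : (L ≃ₐ[ℚ] L) → ℚ, (∀ k, ∑ g, c g • π k g = 0) → c = 0) :
    CMAlgebra.IsNondegenerateFamily Φ ↔ ∑ k : {k : κ // ∀ v, π k ρ v = -v}, Module.finrank (Z k.1) (V k.1) *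
      Module.finrank ℚ (⨆ i, LinearMap.range (∑ g : L ≃ₐ[ℚ] L,
          antiVec ({g : L ≃ₐ[ℚ] L | (ι.comp (g : L →+* L)).comp (e i) ∈ (Φ i).1} : Set (L ≃ₐ[ℚ] L))
            (1 : L ≃ₐ[ℚ] L) g • π k.1 g) : Submodule ℚ (V k.1)) = (∑ i, Module.finrank ℚ (K i)) / 2 := by
  rw [CMAlgebra.isNondegenerateFamily_iff, cmFamilyRank_eq_one_add_sum_odd_of_certificate ι e ρ hρ Φ π hlin hcount hfaith]
  omega

end Summit.HodgeConjecture.CorCM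

end
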